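import Summits.PneNP.PneNP.Theorems.LtfGreedySigning
import Summits.PneNP.PneNP.Theorems.LocalMapDecodeFP

/-!
# F-N2a FP wrapper for general LTF tables, part 1/2: the machine of the weighted greedy pass and its semantics

Cell pnp-ideate, ROUND-17 rung F-N2a (`--supports stmt-PneNP-19007`).  `LtfGreedySigning` proved: for a
`k`-local map `I` with a degree-≤1 certificate `c : SignRepCertificate.Cert I` (rows `c0 j`, `c1 j i`, no
quadratic part, ℓ₁ weight ≤ `W`, margin `τ > 0`) and `(n+1)·W² < τ²·m`, the weighted one-pass greedy
bit-string `greedyBitsW I c` (bias slot included) lies outside `Range(I)`.  To turn this into an FP leaf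
the certificate rows must be a FIXED FUNCTION OF THE OUTPUT'S TABLE (`c0 j = F0 (I.table j)`,
`c1 j i = F1 (I.table j) i` — for fixed `k` a finite table, hard-coded in the machine).  This file is the
machine, parametric in `(F0, F1)`:

* `decode` (`LocalMapDecodeFP`) gives `(table bits, positions)` per output; `tableOfBits` reads the table
  back (`tableOfBits_tabOf`), `certRow` applies `(F0, F1)` (guarded to genuine `2ᵏ`-bit blocks, so that it
  is a finite lookup for the typing), `wrowOf` = the WEIGHTED ROW `(c0 j, [(v_{j,i}, c1 j i)]_i)`;
* the pass `sigRun` is a context-free left fold over the weighted rows: state = signed weighted rows,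
  `biasOf`/`loadOf`/`corrOf` RECOMPUTE the bias slot `B`, the loads `D_v` and the correlation
  `c0·B + Σ_i c1_i·D_{v_i}` (no array updates), new bit = `[0 < correlation]` (= sign `-1`);
* `sigRun_invariant`: bias/loads = `LtfGreedySigning.greedyAuxW I c t none/(some v)`, bits =
  `greedyBitsW I c`; hence `readOut_ltfStr : readOut m (ltfStr k F0 F1 (encode I)) = greedyBitsW I c`.

Typing (`CodeFP`, `IsPolyTime`) and the packaged rung are part 2 (`LtfLocalAvoidFP`).  Restricted-model
algorithmic rung; no bearing on `P` versus `NP`.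
-/

set_option linter.dupNamespace false -- `Summit.PneNP.PneNP.…`: summit = sub-problem name (D-0017 single-conjunct layout)

namespace Summit.PneNP.PneNP.Theorems.LtfLocalAvoidFP

open Literature.Computability.Complexity
open Summit.PneNP.PneNP.Theorems.LtfLocalAvoidCore (sgnZ pickSign)
open Summit.PneNP.PneNP.Theorems.SignRepCertificate (Cert)
open Summit.PneNP.PneNP.Theorems.LtfGreedySigning
open Summit.PneNP.PneNP.Theorems.MajLocalAvoidFP (rowOf length_rowOf)
open Summit.PneNP.PneNP.Theorems.LocalMapDecodeFP

variable {k n m : ℕ}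

/-! ## Tables from table bits -/

/-- All bit-lists of length `n`. -/
def allBits : ℕ → List (List Bool)
  | 0 => [[]]
  | n + 1 => (allBits n).map (List.cons false) ++ (allBits n).map (List.cons true)

/-- `allBits n` lists exactly the bit-lists of length `n`. -/
theorem mem_allBits : ∀ {n : ℕ} {l : List Bool}, l ∈ allBits n ↔ l.length = n
  | 0, l => by cases l <;> simp [allBits]
  | n + 1, [] => by simp [allBits]
  | n + 1, b :: l => by cases b <;> simp [allBits, mem_allBits]

/-- The row index of a bit tuple: `Σ_i 2^i·[u i]` (binary, least significant bit first). -/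
def idxOf : (k : ℕ) → (Fin k → Bool) → ℕ
  | 0, _ => 0
  | k + 1, u => Nat.bit (u 0) (idxOf k fun i => u i.succ)

/-- The row index is below `2ᵏ`. -/
theorem idxOf_lt : ∀ (k : ℕ) (u : Fin k → Bool), idxOf k u < 2 ^ k
  | 0, _ => by simp [idxOf]
  | k + 1, u => by
    have ih := idxOf_lt k fun i => u i.succ
    rw [idxOf, Nat.pow_succ]
    cases u 0 <;> simp [Nat.bit] <;> omega

/-- The bits of the row index are the tuple. -/
theorem testBit_idxOf : ∀ (k : ℕ) (u : Fin k → Bool) (i : Fin k), (idxOf k u).testBit i.val = u i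
  | 0, _, i => i.elim0
  | k + 1, u, i => by
    rw [idxOf]
    refine Fin.cases ?_ (fun i' => ?_) i
    · exact Nat.testBit_bit_zero _ _
    · rw [Fin.val_succ, Nat.testBit_bit_succ, testBit_idxOf k _ i']

/-- The table read back from its `2ᵏ` bits. -/
def tableOfBits (k : ℕ) (tab : List Bool) : (Fin k → Bool) → Bool := fun u => tab.getD (idxOf k u) false

/-- **Reading back the table bits of output `j` gives its table.** -/
theorem tableOfBits_tabOf (I : LocalMap k n m) (j : Fin m) : tableOfBits k (tabOf I j) = I.table j := by
  funext u
  rw [tableOfBits, tabOf, List.getD_eq_getElem?_getD, List.getElem?_ofFn]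
  simp only [idxOf_lt k u, ↓reduceDIte, Option.getD_some]
  congr 1
  funext i
  exact testBit_idxOf k u i

/-! ## Weighted rows -/

section Machine

variable (k : ℕ) (F0 : ((Fin k → Bool) → Bool) → ℤ) (F1 : ((Fin k → Bool) → Bool) → Fin k → ℤ)

/-- The certificate row of a table block: `(F0 P, [F1 P i]_i)` for the table `P` read off the bits
(junk blocks of the wrong length get `(0, [])`, making this a FINITE lookup for the typing). -/
def certRow (tab : List Bool) : ℤ × List ℤ :=
  if tab ∈ allBits (2 ^ k) then (F0 (tableOfBits k tab), List.ofFn fun i : Fin k => F1 (tableOfBits k tab) i)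
  else (0, [])

/-- The weighted row of a decoded output: `(c0, [(position, c1)]_i)`. -/
def wrowOf (o : List Bool × List ℕ) : ℤ × List (ℕ × ℤ) :=
  ((certRow k F0 F1 o.1).1, o.2.zip (certRow k F0 F1 o.1).2)

end Machine

/-- The signed bias slot `B = Σ sign · c0` of the signed weighted rows. -/
def biasOf (st : List (Bool × (ℤ × List (ℕ × ℤ)))) : ℤ := (st.map fun p => sgnZ p.1 * p.2.1).sum

/-- The weight one weighted row puts on position `v`. -/
def pload (wr : List (ℕ × ℤ)) (v : ℕ) : ℤ := (wr.map fun q => if q.1 = v then q.2 else 0).sum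

/-- The signed load `D_v = Σ sign · (weight on v)` of the signed weighted rows. -/
def loadOf (st : List (Bool × (ℤ × List (ℕ × ℤ)))) (v : ℕ) : ℤ := (st.map fun p => sgnZ p.1 * pload p.2.2 v).sum

/-- The correlation `c0·B + Σ_i c1_i · D_{v_i}` of a weighted row with the current state. -/
def corrOf (st : List (Bool × (ℤ × List (ℕ × ℤ)))) (wr : ℤ × List (ℕ × ℤ)) : ℤ :=
  wr.1 * biasOf st + (wr.2.map fun q => q.2 * loadOf st q.1).sum

/-- One greedy step: append the weighted row, signed AGAINST its correlation (bit `true` = sign `-1`). -/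
def sigStep (wr : ℤ × List (ℕ × ℤ)) (st : List (Bool × (ℤ × List (ℕ × ℤ)))) : List (Bool × (ℤ × List (ℕ × ℤ))) :=
  st ++ [(decide (0 < corrOf st wr), wr)]

/-- The signed weighted rows after the one pass. -/
def sigRun (ws : List (ℤ × List (ℕ × ℤ))) : List (Bool × (ℤ × List (ℕ × ℤ))) :=
  ws.foldl (fun st wr => sigStep wr st) []

/-- **THE MACHINE**: decode, weight the rows by the certificate table, run the pass, print the bits. -/
def ltfStr (k : ℕ) (F0 : ((Fin k → Bool) → Bool) → ℤ) (F1 : ((Fin k → Bool) → Bool) → Fin k → ℤ)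
    (w : List Bool) : List Bool :=
  (sigRun ((decode k w).map (wrowOf k F0 F1))).map Prod.fst

/-! ## Semantics against `LtfGreedySigning` -/

/-- The pass keeps the weighted rows (it only attaches a bit to each). -/
theorem map_snd_foldl_sigStep (l : List (ℤ × List (ℕ × ℤ))) : ∀ st₀ : List (Bool × (ℤ × List (ℕ × ℤ))),
    (l.foldl (fun st wr => sigStep wr st) st₀).map Prod.snd = st₀.map Prod.snd ++ l := by
  induction l with
  | nil => intro st₀; simp
  | cons r l ih =>
    intro st₀
    rw [List.foldl_cons, ih, sigStep, List.map_append, List.map_cons, List.map_nil, List.append_assoc,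
      List.singleton_append]

/-- Adding a signed weighted row adds its signed `c0` to the bias slot. -/
theorem biasOf_append_singleton (st : List (Bool × (ℤ × List (ℕ × ℤ)))) (b : Bool) (wr : ℤ × List (ℕ × ℤ)) :
    biasOf (st ++ [(b, wr)]) = biasOf st + sgnZ b * wr.1 := by
  simp [biasOf, List.map_append, List.sum_append]

/-- Adding a signed weighted row adds its signed weights to the loads. -/
theorem loadOf_append_singleton (st : List (Bool × (ℤ × List (ℕ × ℤ)))) (b : Bool) (wr : ℤ × List (ℕ × ℤ)) (v : ℕ) :
    loadOf (st ++ [(b, wr)]) v = loadOf st v + sgnZ b * pload wr.2 v := by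
  simp [loadOf, List.map_append, List.sum_append]

/-- Zipping two `ofFn` lists. -/
theorem zip_ofFn {α β : Type} (f : Fin k → α) (g : Fin k → β) :
    (List.ofFn f).zip (List.ofFn g) = List.ofFn fun i => (f i, g i) := by
  apply List.ext_getElem
  · simp
  · intro i h₁ h₂
    simp [List.getElem_zip]

section Semantics

variable {F0 : ((Fin k → Bool) → Bool) → ℤ} {F1 : ((Fin k → Bool) → Bool) → Fin k → ℤ}
  (I : LocalMap k n m) (c : Cert I)

/-- The weight of a genuine weighted row on position `v` is `wvec … (some v)`. -/
theorem pload_out (j : Fin m) (v : Fin n) :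
    pload (List.ofFn fun i : Fin k => ((I.vars j i).val, c.c1 j i)) v.val = wvec I c j (some v) := by
  rw [pload, List.map_ofFn, List.sum_ofFn, wvec]
  refine Finset.sum_congr rfl fun i _ => ?_
  simp [Fin.ext_iff]

/-- The greedy bit read as a sign is the greedy sign. -/
theorem sgnZ_greedyBitsW (j : Fin m) : sgnZ (greedyBitsW I c j) = greedySignW I c j := by
  unfold greedyBitsW
  rcases greedySignW_cases I c j with h | h <;> simp [h, sgnZ]

/-- The greedy bit is `[0 < correlation]`. -/
theorem greedyBitsW_eq_decide (j : Fin m) :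
    greedyBitsW I c j = decide (0 < ∑ o : Option (Fin n), greedyAuxW I c j.val o * wvec I c j o) := by
  unfold greedyBitsW greedySignW pickSign
  by_cases h : 0 < ∑ o : Option (Fin n), greedyAuxW I c j.val o * wvec I c j o
  · rw [if_pos h, decide_eq_true h]; decide
  · rw [if_neg h, decide_eq_false h]; decide

/-- With the right bias and loads, the machine's correlation of weighted row `t` is the greedy correlation. -/
theorem corrOf_out {st : List (Bool × (ℤ × List (ℕ × ℤ)))} (t : Fin m)
    (hbias : biasOf st = greedyAuxW I c t.val none) (hload : ∀ v : Fin n, loadOf st v.val = greedyAuxW I c t.val (some v)) :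
    corrOf st (c.c0 t, List.ofFn fun i : Fin k => ((I.vars t i).val, c.c1 t i)) =
      ∑ o : Option (Fin n), greedyAuxW I c t.val o * wvec I c t o := by
  have hl : corrOf st (c.c0 t, List.ofFn fun i : Fin k => ((I.vars t i).val, c.c1 t i)) =
      c.c0 t * greedyAuxW I c t.val none + ∑ i : Fin k, c.c1 t i * greedyAuxW I c t.val (some (I.vars t i)) := by
    rw [corrOf, List.map_ofFn, List.sum_ofFn, hbias]
    exact congrArg _ (Finset.sum_congr rfl fun i _ => by
      simp only [Function.comp_apply]; rw [hload (I.vars t i)])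
  rw [hl, Fintype.sum_option]
  simp only [wvec]
  rw [mul_comm]
  congr 1
  simp_rw [Finset.mul_sum, mul_ite, mul_zero]
  rw [Finset.sum_comm]
  refine Finset.sum_congr rfl fun i _ => ?_
  rw [Finset.sum_ite_eq]
  simp [mul_comm]

/-- Weighted row `j` as an `ℕ`-indexed function (junk past `m`). -/
def wrowAt (j : ℕ) : ℤ × List (ℕ × ℤ) :=
  if h : j < m then (c.c0 ⟨j, h⟩, List.ofFn fun i : Fin k => ((I.vars ⟨j, h⟩ i).val, c.c1 ⟨j, h⟩ i)) else (0, [])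

/-- The greedy bit of output `j` as an `ℕ`-indexed function (`false` past `m`). -/
def bitAt (j : ℕ) : Bool := if h : j < m then greedyBitsW I c ⟨j, h⟩ else false

/-- **THE INVARIANT of the pass**: after the first `t` weighted rows the state is those rows signed by
the greedy bits of `LtfGreedySigning`, its bias slot and loads are the greedy slot loads `greedyAuxW I c t`. -/
theorem sigRun_invariant : ∀ t, t ≤ m →
    ((List.range t).map (wrowAt I c)).foldl (fun st wr => sigStep wr st) [] =
        (List.range t).map (fun j => (bitAt I c j, wrowAt I c j)) ∧
      biasOf (((List.range t).map (wrowAt I c)).foldl (fun st wr => sigStep wr st) []) = greedyAuxW I c t none ∧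
      ∀ v : Fin n, loadOf (((List.range t).map (wrowAt I c)).foldl (fun st wr => sigStep wr st) []) v.val =
        greedyAuxW I c t (some v) := by
  intro t
  induction t with
  | zero => intro _; simp [biasOf, loadOf, greedyAuxW]
  | succ t ih =>
    intro ht
    have h : t < m := Nat.lt_of_succ_le ht
    obtain ⟨ih1, ih2, ih3⟩ := ih h.le
    have hrow : wrowAt I c t = (c.c0 ⟨t, h⟩, List.ofFn fun i : Fin k => ((I.vars ⟨t, h⟩ i).val, c.c1 ⟨t, h⟩ i)) :=
      dif_pos h
    have hbit : bitAt I c t = greedyBitsW I c ⟨t, h⟩ := dif_pos h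
    have hstep : ((List.range (t + 1)).map (wrowAt I c)).foldl (fun st wr => sigStep wr st) [] =
        ((List.range t).map (wrowAt I c)).foldl (fun st wr => sigStep wr st) [] ++ [(bitAt I c t, wrowAt I c t)] := by
      rw [List.range_succ, List.map_append, List.foldl_append, List.map_singleton, List.foldl_cons,
        List.foldl_nil, sigStep, hrow, corrOf_out I c ⟨t, h⟩ ih2 ih3, hbit, greedyBitsW_eq_decide]
    refine ⟨?_, ?_, fun v => ?_⟩
    · rw [hstep, ih1, List.range_succ, List.map_append, List.map_singleton]
    · rw [hstep, biasOf_append_singleton, ih2, hbit, hrow, sgnZ_greedyBitsW, greedyAuxW_succ I c t h]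
      rfl
    · rw [hstep, loadOf_append_singleton, ih3, hbit, hrow, sgnZ_greedyBitsW, pload_out, greedyAuxW_succ I c t h]

variable (hc0 : ∀ j, c.c0 j = F0 (I.table j)) (hc1 : ∀ j i, c.c1 j i = F1 (I.table j) i)
include hc0 hc1

/-- The certificate row read off a genuine table block. -/
theorem certRow_tabOf (j : Fin m) : certRow k F0 F1 (tabOf I j) = (c.c0 j, List.ofFn (c.c1 j)) := by
  rw [certRow, if_pos (mem_allBits.2 (length_tabOf I j)), tableOfBits_tabOf, hc0]
  congr 1
  exact congrArg List.ofFn (funext fun i => (hc1 j i).symm)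

/-- The weighted row of a genuine decoded output. -/
theorem wrowOf_out (j : Fin m) :
    wrowOf k F0 F1 (tabOf I j, rowOf I j) = (c.c0 j, List.ofFn fun i : Fin k => ((I.vars j i).val, c.c1 j i)) := by
  rw [wrowOf, certRow_tabOf I c hc0 hc1, rowOf, zip_ofFn]

/-- The weighted rows of the decoded code, listed by index. -/
theorem wrows_eq : (decode k I.encode).map (wrowOf k F0 F1) = (List.range m).map (wrowAt I c) := by
  rw [decode_encode, outsOf, List.map_map, ← List.map_coe_finRange_eq_range, List.map_map]
  refine List.map_congr_left fun j _ => ?_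
  rw [Function.comp_apply, Function.comp_apply, wrowOf_out I c hc0 hc1, wrowAt, dif_pos j.isLt]

/-- **On the code of `I` the machine prints the weighted greedy bits of `LtfGreedySigning`.** -/
theorem ltfStr_encode : ltfStr k F0 F1 I.encode = (List.range m).map (bitAt I c) := by
  rw [ltfStr, sigRun, wrows_eq I c hc0 hc1, (sigRun_invariant I c m le_rfl).1, List.map_map]
  rfl

/-- **The answer read off the machine's output is `greedyBitsW I c`.** -/
theorem readOut_ltfStr : readOut m (ltfStr k F0 F1 I.encode) = greedyBitsW I c := by
  funext j
  rw [readOut, ltfStr_encode I c hc0 hc1, List.getD_eq_getElem?_getD, List.getElem?_map, List.getElem?_range j.isLt]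
  simp [bitAt, j.isLt]

end Semantics

end Summit.PneNP.PneNP.Theorems.LtfLocalAvoidFP
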